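import Literature.NumberTheory.EllipticCurves.IwasawaAlgebraProofs
import Literature.NumberTheory.EllipticCurves.IwasawaAlgebraCharIdealProofs
import Mathlib.RingTheory.QuotSMulTop
import Mathlib.Algebra.Module.SnakeLemma
import HarnessLib

/-!
# Kato's descent (Astérisque 295, Lemma 14.15 / 15.13) — file 1/3: the snake for multiplication by
# `a`, the six-term length identity, the cyclic modules `A/𝔭`, and the DEFINITIONS (`Φ_a`, …)

Helper file for crux K2R0P♭ `stmt-BirchSwinnertonDyer-26471`
(`Summit.BirchSwinnertonDyer.BirchSwinnertonDyer.Theses.ThetaPartnerAtTwo.SignedMainConjectureCMTwoRankZeroOfPubOfFlat`,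
route `ThetaPartnerAtTwo`, line `rankzero` v16, lead prover bsd-wall-tp2-p2 g9, 2026-08-28). Pure
commutative algebra, no carriers, no named fact, nothing about elliptic curves; BSD is not proved by
any of this. PURPOSE: clause (g) of the LOWER package (`ℓ_𝔭(𝐇¹(T~)/Λ z_A) ≤ ℓ_𝔭(X₀)`, port spec
LOWER-LENGTH-SOCKET-w2g2.md §5) descends from the two-variable equality on the `K(p^∞𝔣)`-tower
(Johnson-Leung–Kings 2011, Thm. 5.7 with §7.2 "Proof for regular prime ideals", unconditional at
every height-one `𝔮 ∌ p`) through Kato's Lemma 15.13 (Astérisque 295, p. 264: `A = O_λ⟦G_{p^∞𝔣}⟧_𝔮`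
is a regular local ring of dimension `2`, the kernel of `A → O_λ⟦G_∞⟧_𝔭` is principal `= (a)`,
(15.13.1) `H²_𝔮/aH²_𝔮 ≅ H²(T~)_𝔭`, (15.13.2) `0 → H¹_𝔮/aH¹_𝔮 → H¹(T~)_𝔭 → H²_𝔮[a] → 0`) and
Kato's Lemma 14.15 (p. 243–244). Kato himself (Prop. 15.17) descends only the Euler-system
inequality; the reverse inequality needed here uses ONE further printed input, Kato Thm. 12.4 (2)
(`𝐇¹(T~)` is torsion free, all `p`; for CM forms by 15.15), in the form "`Ann_A(z~) ⊆ (a)`".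

## Contents of this file (all PROVED / honest definitions, Mathlib only; this file carries ALL the
## definitions of the three files so that files 2/3 and 3/3 are theorem-only)
* `length_of_exact_six` : `ℓ(K₂) + ℓ(C₁) + ℓ(C₃) = ℓ(K₁) + ℓ(K₃) + ℓ(C₂)` along
  `0 → K₁ → K₂ → K₃ → C₁ → C₂ → C₃ → 0` (`ℕ∞`, no finiteness).
* `length_tors_quotSMulTop_of_exact` : the snake for `a` on `0 → N₁ → N₂ → N₃ → 0`:
  `ℓ(N₂[a]) + ℓ(N₁/a) + ℓ(N₃/a) = ℓ(N₁[a]) + ℓ(N₃[a]) + ℓ(N₂/a)`; `length_tors_le_of_exact`.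
* `tors_quotient_eq_bot` / `tors_quotient_eq_top` / `quotSMulTopQuotientEquiv` /
  `quotSMulTopQuotientEquivSup` : `(A/𝔭)[a] = 0` for `a ∉ 𝔭`, `(A/I)[a] = A/I` for `a ∈ I`,
  `(A/I)/a ≃ A/(I ⊔ (a))`, `(H/Z)/a ≃ H/(Z ⊔ aH)`.
* `mult a 𝔮 = ℓ_A(A/(𝔮 + aA))`, `phiTerm`, `Phi a M = Σᶠ_{ht 𝔮 = 1} ℓ_𝔮(M) · mult a 𝔮` (Kato's
  right-hand side of 14.15 read in `G(C) ≅ ℤ` by the length).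
Files 2/3 (`…KatoDescentDevissage`): finite support / additivity / monotonicity of `Φ_a` and Lemma
14.15; 3/3 (`…KatoDescent`): the descent inequality.

## References
* K. Kato, *p-adic Hodge theory and values of zeta functions of modular forms*, Astérisque 295
  (2004), Lemma 14.15 (p. 243–244), Lemma 15.13, Prop. 15.17 (p. 264–265), Thm. 12.4 (2) (p. 221).
* J. Johnson-Leung, G. Kings, J. reine angew. Math. 653 (2011), Thm. 5.7, §7.2.
-/

set_option autoImplicit false
set_option linter.dupNamespace false

noncomputable section

open scoped Classical Pointwise

universe u v

namespace Summit.BirchSwinnertonDyer.BirchSwinnertonDyer.Theorems.KatoDescent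

open Literature.NumberTheory.EllipticCurves Literature.NumberTheory.EllipticCurves.Module

/-! ## §1 The snake for multiplication by `a` and the six-term length identity -/

section Six

variable {A : Type*} [CommRing A]

/-- **Lengths in a six-term exact sequence** `0 → K₁ → K₂ → K₃ → C₁ → C₂ → C₃ → 0`:
`ℓ(K₂) + ℓ(C₁) + ℓ(C₃) = ℓ(K₁) + ℓ(K₃) + ℓ(C₂)` in `ℕ∞` (no finiteness needed: split at the
images and add). [folklore] -/
theorem length_of_exact_six {K₁ K₂ K₃ C₁ C₂ C₃ : Type*}
    [AddCommGroup K₁] [Module A K₁] [AddCommGroup K₂] [Module A K₂] [AddCommGroup K₃] [Module A K₃]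
    [AddCommGroup C₁] [Module A C₁] [AddCommGroup C₂] [Module A C₂] [AddCommGroup C₃] [Module A C₃]
    (a₁ : K₁ →ₗ[A] K₂) (a₂ : K₂ →ₗ[A] K₃) (δ : K₃ →ₗ[A] C₁) (b₁ : C₁ →ₗ[A] C₂) (b₂ : C₂ →ₗ[A] C₃)
    (ha₁ : Function.Injective a₁) (h₂ : Function.Exact a₁ a₂) (h₃ : Function.Exact a₂ δ)
    (h₄ : Function.Exact δ b₁) (h₅ : Function.Exact b₁ b₂) (hb₂ : Function.Surjective b₂) :
    Module.length A K₂ + Module.length A C₁ + Module.length A C₃ =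
      Module.length A K₁ + Module.length A K₃ + Module.length A C₂ := by
  -- `ℓ(X) = ℓ(ker φ) + ℓ(range φ)` for each map, and `ker = range` of the previous one
  have hK₂ : Module.length A K₂ = Module.length A K₁ + Module.length A (LinearMap.range a₂) := by
    rw [Module.length_eq_add_of_exact (LinearMap.ker a₂).subtype a₂.rangeRestrict
      (Submodule.subtype_injective _) a₂.surjective_rangeRestrict
      (LinearMap.exact_iff.mpr (by rw [LinearMap.ker_rangeRestrict, Submodule.range_subtype])),
      LinearMap.exact_iff.mp h₂, ← (LinearEquiv.ofInjective a₁ ha₁).length_eq]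
  have hK₃ : Module.length A K₃ =
      Module.length A (LinearMap.range a₂) + Module.length A (LinearMap.range δ) := by
    rw [Module.length_eq_add_of_exact (LinearMap.ker δ).subtype δ.rangeRestrict
      (Submodule.subtype_injective _) δ.surjective_rangeRestrict
      (LinearMap.exact_iff.mpr (by rw [LinearMap.ker_rangeRestrict, Submodule.range_subtype])),
      LinearMap.exact_iff.mp h₃]
  have hC₁ : Module.length A C₁ =
      Module.length A (LinearMap.range δ) + Module.length A (LinearMap.range b₁) := by
    rw [Module.length_eq_add_of_exact (LinearMap.ker b₁).subtype b₁.rangeRestrict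
      (Submodule.subtype_injective _) b₁.surjective_rangeRestrict
      (LinearMap.exact_iff.mpr (by rw [LinearMap.ker_rangeRestrict, Submodule.range_subtype])),
      LinearMap.exact_iff.mp h₄]
  have hC₂ : Module.length A C₂ = Module.length A (LinearMap.range b₁) + Module.length A C₃ := by
    rw [Module.length_eq_add_of_exact (LinearMap.ker b₂).subtype b₂
      (Submodule.subtype_injective _) hb₂ (LinearMap.exact_subtype_ker_map b₂),
      LinearMap.exact_iff.mp h₅]
  rw [hK₂, hK₃, hC₁, hC₂]
  ring

variable (a : A)

/-- `M[a]`, the kernel of multiplication by `a` (Mathlib `Submodule.torsionBy`). [folklore] -/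
abbrev tors (M : Type*) [AddCommGroup M] [Module A M] : Submodule A M :=
  Submodule.torsionBy A M a

/-- Multiplication by `a` as a linear endomorphism. [folklore] -/
abbrev mulA (M : Type*) [AddCommGroup M] [Module A M] : M →ₗ[A] M :=
  DistribSMul.toLinearMap A M a

variable {a}
variable {N₁ N₂ N₃ : Type*} [AddCommGroup N₁] [Module A N₁] [AddCommGroup N₂] [Module A N₂]
  [AddCommGroup N₃] [Module A N₃]
  (f : N₁ →ₗ[A] N₂) (g : N₂ →ₗ[A] N₃)

/-- `m ∈ M[a] ↔ a • m = 0`. [folklore] -/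
theorem mem_tors_iff {M : Type*} [AddCommGroup M] [Module A M] (m : M) :
    m ∈ tors a M ↔ a • m = 0 :=
  Submodule.mem_torsionBy_iff _ _

/-- `m ∈ a • M ↔ m = a • y` for some `y`. [folklore] -/
theorem mem_smul_top_iff {M : Type*} [AddCommGroup M] [Module A M] (m : M) :
    m ∈ a • (⊤ : Submodule A M) ↔ ∃ y : M, a • y = m := by
  rw [Submodule.mem_smul_pointwise_iff_exists]
  constructor
  · rintro ⟨y, -, rfl⟩
    exact ⟨y, rfl⟩
  · rintro ⟨y, rfl⟩
    exact ⟨y, Submodule.mem_top, rfl⟩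

/-- The image of multiplication by `a` is `aM`. [folklore] -/
theorem range_mulA (M : Type*) [AddCommGroup M] [Module A M] :
    LinearMap.range (mulA a M) = a • (⊤ : Submodule A M) := by
  ext y
  rw [LinearMap.mem_range, mem_smul_top_iff]
  rfl

/-- Exactness of `0 → M[a] → M →(a) M`. [folklore] -/
theorem exact_subtype_mulA (M : Type*) [AddCommGroup M] [Module A M] :
    Function.Exact (tors a M).subtype (mulA a M) :=
  LinearMap.exact_subtype_ker_map _

/-- Exactness of `M →(a) M → M/aM → 0`. [folklore] -/
theorem exact_mulA_mkQ (M : Type*) [AddCommGroup M] [Module A M] :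
    Function.Exact (mulA a M) (a • (⊤ : Submodule A M)).mkQ := by
  rw [LinearMap.exact_iff, Submodule.ker_mkQ, range_mulA]

variable (a)

/-- `f` restricted to `N₁[a] → N₂[a]`. [folklore] -/
def torsMap : tors a N₁ →ₗ[A] tors a N₂ :=
  f.restrict fun x hx ↦ by
    rw [mem_tors_iff] at hx ⊢
    rw [← map_smul, hx, map_zero]

/-- Unfolding of `torsMap`. [folklore] -/
@[simp] theorem torsMap_apply (x : tors a N₁) : ((torsMap a f x : tors a N₂) : N₂) = f x := rfl

variable {a}

include f in
/-- `N₁[a] → N₂[a]` is injective if `N₁ → N₂` is. [folklore] -/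
theorem torsMap_injective (hf : Function.Injective f) : Function.Injective (torsMap a f) := by
  intro x y hxy
  apply Subtype.ext
  apply hf
  have := congrArg (fun z : tors a N₂ ↦ (z : N₂)) hxy
  simpa using this

/-- Exactness at `N₂[a]` of `N₁[a] → N₂[a] → N₃[a]` (left exactness of `(·)[a]`). [folklore] -/
theorem exact_torsMap (hf : Function.Injective f) (hfg : Function.Exact f g) :
    Function.Exact (torsMap a f) (torsMap a g) := by
  intro x
  constructor
  · intro hx
    have hx' : g (x : N₂) = 0 := by
      have := congrArg (fun z : tors a N₃ ↦ (z : N₃)) hx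
      simpa using this
    obtain ⟨y, hy⟩ := (hfg (x : N₂)).mp hx'
    have hyT : y ∈ tors a N₁ := by
      rw [mem_tors_iff]
      apply hf
      rw [map_smul, hy, map_zero]
      exact (mem_tors_iff (x : N₂)).mp x.2
    exact ⟨⟨y, hyT⟩, Subtype.ext (by simp [hy])⟩
  · rintro ⟨y, rfl⟩
    apply Subtype.ext
    change g (f y) = 0
    exact (hfg (f y)).mpr ⟨y, rfl⟩

/-- The connecting map `δ : N₃[a] → N₁/aN₁` of the snake lemma for multiplication by `a` on
`0 → N₁ → N₂ → N₃ → 0` (Mathlib's `SnakeLemma.δ'`). [folklore] -/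
def snakeDelta (hf : Function.Injective f) (hg : Function.Surjective g)
    (hfg : Function.Exact f g) : tors a N₃ →ₗ[A] QuotSMulTop a N₁ :=
  SnakeLemma.δ' (mulA a N₁) (mulA a N₂) (mulA a N₃) f g hfg f g hfg
    (by ext; simp) (by ext; simp)
    (tors a N₃).subtype (exact_subtype_mulA N₃)
    (a • (⊤ : Submodule A N₁)).mkQ (exact_mulA_mkQ N₁) hg hf

/-- Exactness at `N₃[a]`: `N₂[a] → N₃[a] →δ N₁/aN₁`. [folklore] -/
theorem exact_torsMap_snakeDelta (hf : Function.Injective f) (hg : Function.Surjective g)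
    (hfg : Function.Exact f g) :
    Function.Exact (torsMap a g) (snakeDelta f g hf hg hfg) :=
  SnakeLemma.exact_δ'_right (mulA a N₁) (mulA a N₂) (mulA a N₃) f g hfg f g hfg
    (by ext; simp) (by ext; simp)
    (tors a N₂).subtype (exact_subtype_mulA N₂)
    (tors a N₃).subtype (exact_subtype_mulA N₃)
    (a • (⊤ : Submodule A N₁)).mkQ (exact_mulA_mkQ N₁) hg hf
    (torsMap a g) (by ext; simp) (Submodule.subtype_injective _)

/-- Exactness at `N₁/aN₁`: `N₃[a] →δ N₁/aN₁ → N₂/aN₂`. [folklore] -/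
theorem exact_snakeDelta_map (hf : Function.Injective f) (hg : Function.Surjective g)
    (hfg : Function.Exact f g) :
    Function.Exact (snakeDelta f g hf hg hfg) (QuotSMulTop.map a f) :=
  SnakeLemma.exact_δ'_left (mulA a N₁) (mulA a N₂) (mulA a N₃) f g hfg f g hfg
    (by ext; simp) (by ext; simp)
    (tors a N₃).subtype (exact_subtype_mulA N₃)
    (a • (⊤ : Submodule A N₁)).mkQ (exact_mulA_mkQ N₁)
    (a • (⊤ : Submodule A N₂)).mkQ (exact_mulA_mkQ N₂) hg hf
    (QuotSMulTop.map a f) (by ext; simp) (Submodule.mkQ_surjective _)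

/-- `N₁/aN₁ → N₂/aN₂` is injective... no: only the **length identity of the snake for `a`** along
`0 → N₁ → N₂ → N₃ → 0`:
`ℓ(N₂[a]) + ℓ(N₁/aN₁) + ℓ(N₃/aN₃) = ℓ(N₁[a]) + ℓ(N₃[a]) + ℓ(N₂/aN₂)` in `ℕ∞`. [folklore] -/
theorem length_tors_quotSMulTop_of_exact (hf : Function.Injective f) (hg : Function.Surjective g)
    (hfg : Function.Exact f g) :
    Module.length A (tors a N₂) + Module.length A (QuotSMulTop a N₁) +
        Module.length A (QuotSMulTop a N₃) =
      Module.length A (tors a N₁) + Module.length A (tors a N₃) +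
        Module.length A (QuotSMulTop a N₂) :=
  length_of_exact_six (torsMap a f) (torsMap a g) (snakeDelta f g hf hg hfg)
    (QuotSMulTop.map a f) (QuotSMulTop.map a g) (torsMap_injective f hf)
    (exact_torsMap f g hf hfg) (exact_torsMap_snakeDelta f g hf hg hfg)
    (exact_snakeDelta_map f g hf hg hfg) (QuotSMulTop.map_exact a hfg hg)
    (QuotSMulTop.map_surjective a hg)

/-- `ℓ(N₂[a]) ≤ ℓ(N₁[a]) + ℓ(N₃[a])` along `0 → N₁ → N₂ → N₃` (left exactness). [folklore] -/
theorem length_tors_le_of_exact (hf : Function.Injective f) (hfg : Function.Exact f g) :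
    Module.length A (tors a N₂) ≤ Module.length A (tors a N₁) + Module.length A (tors a N₃) := by
  rw [Module.length_eq_add_of_exact (LinearMap.ker (torsMap a g)).subtype
    (torsMap a g).rangeRestrict (Submodule.subtype_injective _)
    (torsMap a g).surjective_rangeRestrict
    (LinearMap.exact_iff.mpr (by rw [LinearMap.ker_rangeRestrict, Submodule.range_subtype])),
    LinearMap.exact_iff.mp (exact_torsMap f g hf hfg),
    ← (LinearEquiv.ofInjective _ (torsMap_injective f hf)).length_eq]
  gcongr
  exact Module.length_le_of_injective (LinearMap.range (torsMap a g)).subtype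
    (Submodule.subtype_injective _)

/-! ### Transport along linear equivalences -/

/-- `N[a] ≃ N'[a]` along `N ≃ N'`. [folklore] -/
def torsEquiv {N N' : Type*} [AddCommGroup N] [Module A N] [AddCommGroup N'] [Module A N']
    (e : N ≃ₗ[A] N') : tors a N ≃ₗ[A] tors a N' :=
  LinearEquiv.ofBijective (torsMap a e.toLinearMap)
    ⟨torsMap_injective e.toLinearMap e.injective, fun y ↦ by
      refine ⟨⟨e.symm y, ?_⟩, ?_⟩
      · rw [mem_tors_iff, ← LinearEquiv.map_smul, (mem_tors_iff (y : N')).mp y.2, map_zero]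
      · apply Subtype.ext
        simp⟩

/-- `N/aN ≃ N'/aN'` along `N ≃ N'`. [folklore] -/
def quotSMulTopEquiv {N N' : Type*} [AddCommGroup N] [Module A N] [AddCommGroup N']
    [Module A N'] (e : N ≃ₗ[A] N') : QuotSMulTop a N ≃ₗ[A] QuotSMulTop a N' :=
  LinearEquiv.ofBijective (QuotSMulTop.map a e.toLinearMap)
    ⟨by
      rw [← LinearMap.ker_eq_bot, eq_bot_iff]
      intro q hq
      induction q using Submodule.Quotient.induction_on with
      | H x =>
        rw [LinearMap.mem_ker, QuotSMulTop.map_apply_mk, Submodule.Quotient.mk_eq_zero,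
          mem_smul_top_iff] at hq
        obtain ⟨z, hz⟩ := hq
        rw [Submodule.mem_bot, Submodule.Quotient.mk_eq_zero, mem_smul_top_iff]
        refine ⟨e.symm z, e.injective ?_⟩
        rw [LinearEquiv.map_smul, LinearEquiv.apply_symm_apply]
        exact hz,
      QuotSMulTop.map_surjective a e.surjective⟩

end Six

/-! ## §2 The cyclic modules `A ⧸ 𝔭` -/

section Cyclic

variable {A : Type*} [CommRing A] {a : A}

/-- If `a ∉ 𝔭` (a prime) then `(A/𝔭)[a] = 0`. [folklore] -/
theorem tors_quotient_eq_bot {𝔭 : PrimeSpectrum A} (ha : a ∉ 𝔭.asIdeal) :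
    tors a (A ⧸ 𝔭.asIdeal) = ⊥ := by
  rw [eq_bot_iff]
  intro y hy
  obtain ⟨b, rfl⟩ := Ideal.Quotient.mk_surjective y
  rw [mem_tors_iff, Algebra.smul_def, Ideal.Quotient.algebraMap_eq, ← map_mul,
    Ideal.Quotient.eq_zero_iff_mem] at hy
  rw [Submodule.mem_bot, Ideal.Quotient.eq_zero_iff_mem]
  exact (𝔭.isPrime.mem_or_mem hy).resolve_left ha

/-- If `a ∈ I` then `(A/I)[a] = A/I`. [folklore] -/
theorem tors_quotient_eq_top {I : Ideal A} (ha : a ∈ I) : tors a (A ⧸ I) = ⊤ := by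
  rw [eq_top_iff]
  intro y _
  obtain ⟨b, rfl⟩ := Ideal.Quotient.mk_surjective y
  rw [mem_tors_iff, Algebra.smul_def, Ideal.Quotient.algebraMap_eq, ← map_mul,
    Ideal.Quotient.eq_zero_iff_mem]
  exact I.mul_mem_right _ ha

/-- `a · (A/I) = ((a) ⊔ I)/I` as a submodule of `A/I`. [folklore] -/
theorem smul_top_quotient_eq_map (I : Ideal A) :
    a • (⊤ : Submodule A (A ⧸ I)) = Submodule.map (Submodule.mkQ I) (Ideal.span {a}) := by
  ext y
  rw [mem_smul_top_iff, Submodule.mem_map]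
  constructor
  · rintro ⟨z, rfl⟩
    obtain ⟨b, rfl⟩ := Submodule.Quotient.mk_surjective I z
    exact ⟨a * b, Ideal.mem_span_singleton'.mpr ⟨b, mul_comm _ _⟩, rfl⟩
  · rintro ⟨h, hh, rfl⟩
    obtain ⟨b, rfl⟩ := Ideal.mem_span_singleton'.mp hh
    exact ⟨Submodule.Quotient.mk b, by
      rw [Submodule.mkQ_apply, mul_comm, ← smul_eq_mul, Submodule.Quotient.mk_smul]⟩

/-- `(A/I)/a(A/I) ≃ A/(I + (a))`. [folklore] -/
def quotSMulTopQuotientEquiv (I : Ideal A) :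
    QuotSMulTop a (A ⧸ I) ≃ₗ[A] A ⧸ (I ⊔ Ideal.span {a}) :=
  (Submodule.quotEquivOfEq _ _ (smul_top_quotient_eq_map I)) ≪≫ₗ
    Submodule.quotientQuotientEquivQuotientSup I (Ideal.span {a})

end Cyclic

/-! ## §3a Definitions: Kato's right-hand side `Φ_a(M) = Σ_{ht 𝔮 = 1} ℓ_𝔮(M) · ℓ_A(A/(𝔮 + aA))` -/

section PhiDefs

variable {A : Type*} [CommRing A]

/-- **Kato's multiplicity** of the height-one prime `𝔮` against `a`: `m_a(𝔮) = ℓ_A(A/(𝔮 + aA))`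
(the class `[A/(𝔮 + aA)]` of Lemma 14.15 read through the length; `⊤` is allowed and harmless).
[cite: Kato2004Asterisque, Lemma 14.15 (p. 243)] -/
def mult (a : A) (𝔮 : PrimeSpectrum A) : ℕ∞ :=
  Module.length A (A ⧸ (𝔮.asIdeal ⊔ Ideal.span {a}))

/-- The `𝔮`-term of `Φ_a(M)`: `ℓ_𝔮(M) · m_a(𝔮)` at a height-one prime, `0` elsewhere. [folklore] -/
def phiTerm (a : A) (M : Type*) [AddCommGroup M] [Module A M] (𝔮 : PrimeSpectrum A) : ℕ∞ :=
  if 𝔮.asIdeal.height = 1 then lengthAt A M 𝔮 * mult a 𝔮 else 0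

/-- **`Φ_a(M) = Σ_{ht 𝔮 = 1} ℓ_𝔮(M) · ℓ_A(A/(𝔮 + aA))`** — the right-hand side of Kato's Lemma 14.15
`[M/aM] − [ₐM] = Σ_𝔮 length(M_𝔮) · [A/(𝔮 + aA)]` read in `G(C) ≅ ℤ` through the length (a
`finsum`; junk value `0` on infinite support, vacuous for finitely generated torsion modules over a
Noetherian domain). The primes `𝔮 ∋ a` contribute `ℓ_𝔮(M) · m_a(𝔮)`, which is `0` under the lemma's
hypothesis `M_𝔮 = 0`. [cite: Kato2004Asterisque, Lemma 14.15 (p. 243–244)] -/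
def Phi (a : A) (M : Type*) [AddCommGroup M] [Module A M] : ℕ∞ :=
  ∑ᶠ 𝔮 : PrimeSpectrum A, phiTerm a M 𝔮

/-- `(H/Z)/a(H/Z) ≃ H/(Z ⊔ aH)`. [folklore] -/
def quotSMulTopQuotientEquivSup (a : A) {H : Type*} [AddCommGroup H] [Module A H]
    (Z : Submodule A H) : QuotSMulTop a (H ⧸ Z) ≃ₗ[A] H ⧸ (Z ⊔ a • (⊤ : Submodule A H)) :=
  (Submodule.quotEquivOfEq _ _ (by
    rw [Submodule.map_pointwise_smul, Submodule.map_top, Submodule.range_mkQ])) ≪≫ₗ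
    Submodule.quotientQuotientEquivQuotientSup Z (a • (⊤ : Submodule A H))

end PhiDefs

end Summit.BirchSwinnertonDyer.BirchSwinnertonDyer.Theorems.KatoDescent

end
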